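import Summits.ResolutionOfSingularities.ResolutionOfSingularities.Theses.DefectlessFrames
import Summits.ResolutionOfSingularities.ResolutionOfSingularities.Theses.ShadowGame
import Summits.ResolutionOfSingularities.ResolutionOfSingularities.Theses.FrobeniusClosing
import Summits.ResolutionOfSingularities.ResolutionOfSingularities.Theses.WildCones
import Summits.ResolutionOfSingularities.ResolutionOfSingularities.Theses.FoliationDescent
import Summits.ResolutionOfSingularities.ResolutionOfSingularities.Theses.InertialGeneration
import Summits.ResolutionOfSingularities.ResolutionOfSingularities.Theses.JacobianBudget
import Summits.ResolutionOfSingularities.ResolutionOfSingularities.Theorems.PatchingRel.Negative.HighDimSlice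
import Summits.ResolutionOfSingularities.ResolutionOfSingularities.Theorems.PatchingRel.Negative.LUrelWithoutRFG
import Literature.AlgebraicGeometry.Resolution.ResolutionLU
import Literature.AlgebraicGeometry.Resolution.GeneralLU
import Literature.AlgebraicGeometry.Resolution.NonReducedNoResolution
import Literature.AlgebraicGeometry.Resolution.AbsoluteIntegralClosureNoResolution
import Literature.AlgebraicGeometry.Resolution.AffineModelObstructions
import Literature.AlgebraicGeometry.Resolution.LocalUniformizationClosedPoints
import Literature.AlgebraicGeometry.Resolution.LocalUniformizationAbhyankarPlaces
import Literature.AlgebraicGeometry.Resolution.LocalUniformizationEssFiniteType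
import Literature.AlgebraicGeometry.Resolution.Blowups
import Literature.AlgebraicGeometry.Resolution.BlowupsFlatBaseChange
import Literature.AlgebraicGeometry.Resolution.BlowupsIntegral
import Literature.AlgebraicGeometry.Resolution.BlowupsComposition
import Literature.AlgebraicGeometry.Resolution.BlowupsProperProofs
import Literature.AlgebraicGeometry.Resolution.BlowupsFacts
import Literature.AlgebraicGeometry.Resolution.AdicCompletionRegular
import Literature.AlgebraicGeometry.Resolution.ProjectiveSpaceRegular

/-!
# Disproof of `PatchingRelPerfect` (stmt-ResolutionOfSingularities-16161) — standing disprover's work file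

Crux (shared verbatim by SEVEN routes — `DefectlessFrames` #5, `ShadowGame` #4, `FrobeniusClosing`,
`WildCones`, `FoliationDescent`, `InertialGeneration`, `JacobianBudget`; one term, §0):
`PatchingRelPerfect : ∀ p prime, LUrelPerfect_p → ResPerfect_p` — relative Zariski local
uniformization for every finitely generated `K/k` over every PERFECT field `k` of characteristic
`p` implies that every reduced separated scheme of finite type over every PERFECT field of
characteristic `p` has a resolution. It is the perfect-ground-field FIBRE of the all-fields twin
`Valuative.PatchingRel` (stmt-0642; six disprover generations on file in
`Cruxes/PatchingRel/Disproof.lean`, verdict RESISTS) — every per-field theorem of that analysis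
re-runs here with `[PerfectField k]` carried, and is re-derived below from the TREE files the twin
landed (not from its work file).

## Findings (cycle 1, 2026-08-17)

* §0 `patchingRelPerfect_iff` (`Iff.rfl`) and the seven route copies are one term.
* §1 WHY IT RESISTS (all proved): `lurelPerfect_of_resPerfect` — the converse `ResPerfect_p →
  LUrelPerfect_p` holds FIBREWISE (valuative criterion on a resolution of `Spec (R ⊔ A₀)`, tree
  `exists_affineModel_regular_of_hasResolution`), so `not_patchingRelPerfect_iff :
  ¬ PatchingRelPerfect ↔ ∃ p prime, LUrelPerfect_p ∧ ¬ ResPerfect_p`: a kill must PROVE local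
  uniformization over perfect fields in some characteristic `p` (open in transcendence degree
  `≥ 4`, and by §2 exactly at zero-dimensional NON-Abhyankar places) AND refute resolution over a
  perfect field there. `summitPerfect_iff : (∀ p prime, ResPerfect_p) ↔ (∀ p prime,
  LUrelPerfect_p) ∧ PatchingRelPerfect`; the summit implies the crux
  (`patchingRelPerfect_of_summit`); under LU the crux IS resolution over perfect fields.
* §2 LOAD-BEARING ANALYSIS OF THE ANTECEDENT `LUrelPerfect_p` (each clause dropped in turn):
  (H1) `p.Prime` — not load-bearing (`patchingRelPerfectAllChar_iff` mod `Hironaka1964`);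
  (H2) `k ⊆ O` — redundant (`lurelPerfectNoConst_iff`);
  (H3) `(⊤ : IntermediateField k K).FG` — load-bearing FOR THE ANTECEDENT: dropped, the
  antecedent is FALSE at the perfect field `𝔽_p` (`not_lurelPerfectNoFG`, witness
  `𝔽_p^alg / 𝔽_p`, tree `not_exists_fg_isFractionRing_algebraicClosure`) and the crux becomes
  VACUOUSLY true (`patchingRelPerfectNoFG_holds`) — a trap;
  (H4) `IsFractionRing A K` — redundant (`lurelPerfectNoFrac_iff`);
  (H5) `R.FG` — load-bearing for the antecedent exactly like (H3) (`not_lurelPerfectNoRFG`,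
  witness `R = K = 𝔽_p(X)` at the trivial valuation; second trap `patchingRelPerfectNoRFG_holds`);
  (H6) regularity at the centre — THE content: dropped, the antecedent is trivially true
  (`lurelPerfectNoReg_holds`) and the crux collapses to resolution over perfect fields
  (`patchingRelPerfectNoReg_iff`);
  (H7) the antecedent is FREE at valuation rings essentially of finite type over `k`
  (`lurelPerfect_free_at_essFiniteType`, tree `lurel_of_essFiniteType`), in particular at the
  trivial valuation (`lurelPerfect_at_top`) — every junk instance a refuter tries first is TRUE;
  (H8) `lurelPerfectZeroDim_iff` — LU at ZERO-DIMENSIONAL valuation rings (closed points of the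
  Zariski–Riemann space) is EQUIVALENT to the full antecedent (tree `relLU_of_relLU_zeroDim`);
  (H8c) `lurelPerfect_free_at_abhyankarPlace`, `lurelPerfectHard_iff` — PERFECT-SPECIFIC: the
  antecedent is FREE at Abhyankar places (Knaf–Kuhlmann 2005, tree
  `relLU_at_abhyankarPlace_of_perfectField`, separability of the residue extension being
  automatic over a perfect ground field) and EQUIVALENT to its hard core "LU at zero-dimensional
  non-Abhyankar valuation rings" — Kuhlmann's defect / rank-deficient places, present from
  transcendence degree `2` on; so `patchingRelPerfect_iff_hard`.
  (H9) `[PerfectField k]` in the ANTECEDENT dropped gives `LUrel_p → ResPerfect_p`, WEAKER than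
  both the crux and the twin (`patchingRelPerfect_of_weakTwin`), irrefutable short of `¬ Res`.
* §3 CONSEQUENT MUTATIONS: (C1) `IsReduced` dropped — FALSE over the perfect field `𝔽_p`
  (`not_resPerfectNoReduced`, witness `Spec 𝔽_p[ε]`, tree `not_hasResolution_spec_dualNumber`),
  so `patchingRelPerfectNoReduced_iff : … ↔ ∀ p prime, ¬ LUrelPerfect_p`; (C2)
  `LocallyOfFiniteType` dropped — FALSE over `𝔽_p` (`not_resPerfectNoFT`, witness `Spec 𝔽_p[X]⁺`,
  tree `not_hasResolution_spec_absoluteIntegralClosure`), so `patchingRelPerfectNoFT_iff : … ↔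
  ∀ p prime, ¬ LUrelPerfect_p`; (C3) `[PerfectField k]` in the CONSEQUENT dropped gives
  `LUrelPerfect_p → Res_p`, which IMPLIES the twin `PatchingRel` (`patchingRel_of_strongTwin`) and
  follows from the crux plus `DescentPerfectToAll` (`strongTwin_of_patchingRelPerfect_of_descent`)
  — open, not refutable; (C4) `QuasiCompact` / `IsSeparated` dropped — not refutable (disjoint
  unions / needs functorial resolution to glue), not formalised; (C5) regular `X` are TRUE
  instances of the consequent (`Scheme.IsRegular.hasResolution`), the empty scheme included.
* §4 DIMENSION SLICE (mod the named fact `CossartPiltant2019`): `lurelPerfect_trdeg_le_three`,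
  `resPerfect_dim_le_three`, `patchingRelPerfect_iff_highDim` — both ends are theorems up to
  dimension three, so the crux is EQUIVALENT to "LU over perfect fields in trdeg `≥ 4` ⇒
  resolution over perfect fields in dim `≥ 4`"; the settled range gives no leverage.
* §5 TARGETS (the registered line `birth`, stubs `stub_sandwichedOfLU`, `stub_patchingOfSandwiched`;
  payload targets = ∅ this cycle): both stub conclusions are consequences of `ResPerfect_p`
  (`Lines/birth.lean`: `sandwichedLocusPerfect_of_resPerfect`, `twoModelPatchingPerfect_of_resPerfect`,
  kernel-checked there), hence IRREFUTABLE short of a counterexample to resolution over a perfect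
  field; the atom `stub_sandwichedOfLU` has no slack (`PatchingRelPerfect ↔ Sig.stub_sandwichedOfLU`
  modulo the paper-true patching stub). Nothing to kill; recorded.
* §6 Regimes tried and why none bites (docstring at the end).

## Findings (cycle 2, 2026-08-17, gen 2) — §7: the registered line `closed-point-slice`

Targets = the four stubs of `Lines/closed_point_slice.lean` (skeleton d35ef396…): the ATOM
`stub_punctualCompletePerfectFour : PunctualCompletePerfect p 4` (punctual resolution in
single-blow-up format over a complete regular local base of dimension `≤ 4`, char `p`, PERFECT
residue field), `stub_algebraize` (completion descent), `stub_dimFourEngine` (LU + fibre-free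
closed-point resolution ⇒ integral dim-≤-4 slice), `stub_dimGeFive` (the residual). Results
(all kernel-checked unless marked; the sorry-free ones LANDED as
`Theorems/PatchingRelPerfect/Negative/PunctualAtom.lean`, p153213):
* §7.1 the three non-atom stubs are irrefutable short of `¬ Res`: the residual's and the engine's
  conclusions are restrictions of `ResPerfect p`; `stub_algebraize`'s conclusion is the fibre-free
  STRONG form, a consequence of strong resolution (printed in dim `≤ 3`, CP2019 Thm 1.1 (ii)).
* §7.2 the atom's FORMAT is not attackable: its conclusion IS a fibre-free resolution of `T`
  (`isResolution_and_isIso_offFibre_of_atomConclusion`: proper 02NS, birational 02ND, iso off the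
  fibre — all proved in tree), and conversely ANY finite tower of blow-ups centred over the closed
  point collapses to ONE non-zero fibre-cosupported blow-up (`atomConclusion_of_two_step`, Raynaud
  / Stacks 080B via tree `IsBlowup.exists_isBlowup_comp_supported`; `isBlowup_ne_bot_of_nonempty`):
  atom ⟺ "resolution of `T` by finitely many blow-ups over the closed point", the output format of
  every algorithm; it sits between weak and strong local resolution in dimension 4.
* §7.3 LOAD-BEARING ANALYSIS of the atom: (A1) "regular off the closed fibre" is FORCED by the
  conclusion (`isRegularLocalRing_stalk_of_isBlowup_of_notMem_support`), so the atom without it is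
  `atom ∧ OffFibreRegularAll` (`punctualCompletePerfectNoOffFibre_iff`), false from `n = 3`
  (witness `Bl_{(x²,y³)} Spec κ[[x,y,z]]`, singular over the non-closed point `(x,y)`; the witness
  is a NEAR-MISS `not_offFibreRegularAll_three`, sorried: chart-ring algebra unbuilt); (A2)
  `IsBirational f` dropped makes the dimension bound void — at `n = 0` with `S := κ` the mutated
  atom resolves EVERY integral proper scheme over every perfect field in every dimension by one
  blow-up (`resolution_all_dims_of_punctualNoBirational_zero`); (A3) the base case `n = 0` of the
  atom HOLDS (`punctualCompletePerfect_zero`: `J = ⊤`, identity blow-up; so `J ≠ ⊥` is the right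
  exclusion and the typing is jointly satisfiable); (A4) monotone in `n`. §7.4: perfectness,
  completeness, properness, integrality, `J ≠ ⊥` — paper analysis (tools / conveniences /
  near-redundant; none yields a refutation).

LANDED NEGATIVE LEMMAS (importable, `Summit.….Theorems.PatchingRelPerfect.Negative.*`):
`Theorems/PatchingRelPerfect/Negative/PunctualAtom.lean` (p153213: the sorry-free content of §7 —
`isRegularLocalRing_stalk_of_isBlowup_of_notMem_support`, `isBlowup_ne_bot_of_nonempty`,
`exists_isBlowup_supported_of_tower`, `atomConclusion_of_two_step`,
`isResolution_and_isIso_offFibre_of_atomConclusion`, `offFibre_regular_of_atom_without_offFibre_hyp`,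
`punctual_atom_dim_zero`, `resolution_all_dims_of_atom_without_birational`) and
`Theorems/PatchingRelPerfect/Negative/LoadBearing.lean` (p153792: the crux-level content of §1–§3 —
`lurelPerfect_of_resPerfect`, `not_patchingRelPerfect_iff`,
`patchingRelPerfect_iff_resPerfect_of_lurelPerfect`, `not_lurelPerfect_without_fg` / `_rfg` with the
two `_vacuous` traps, `patchingRelPerfect_without_reduced_iff` / `_finiteType_iff`).

Verdict (cycle 2): RESISTS. The line's atom is irrefutable short of an integral fourfold `T`,
proper and birational over a complete regular local fourfold base with perfect residue field,
regular off the closed fibre, which NO finite sequence of blow-ups centred over the closed point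
desingularizes — a counterexample to algorithmic resolution in dimension four (CP2019 Rem. 3.2's
`Z^p + u₄u₁^p + u₃u₂^p ∈ κ[[u₁..u₄]]` is the natural first probe for a prover, not a known
counterexample). 0 of 4 targets broken; 2 hypotheses of the atom certified load-bearing, 1 base
case proved, format certified slack-free.

Verdict (cycle 1): RESISTS; not misstated (no missing side condition after (H1)–(H9),
(C1)–(C5)); `¬ crux` is summit-hard: it needs `LUrelPerfect_p ∧ ¬ ResPerfect_p` (§1), i.e. a
proof of local uniformization at Kuhlmann's defect places over a perfect field in transcendence
degree `≥ 4` (§2 (H8c), §4) together with a fourfold over a perfect field without resolution.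
-/

set_option linter.dupNamespace false

noncomputable section

namespace Summit.ResolutionOfSingularities.ResolutionOfSingularities.Cruxes.PatchingRelPerfect.Disproof

open Literature.AlgebraicGeometry.Resolution
open Summit.ResolutionOfSingularities.ResolutionOfSingularities.Theses
open CategoryTheory AlgebraicGeometry

/-! ## §0 The crux, unfolded -/

/-- `LUrelPerfect_p`: relative Zariski local uniformization in characteristic `p` over PERFECT
ground fields (the antecedent of the crux at `p`, verbatim). -/
def LUrelPerfect (p : ℕ) : Prop :=
  ∀ (k K : Type) [Field k] [CharP k p] [PerfectField k] [Field K] [Algebra k K],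
    (⊤ : IntermediateField k K).FG →
    ∀ O : ValuationSubring K, (∀ c : k, algebraMap k K c ∈ O) → ∀ R : Subalgebra k K, R.FG →
      R.toSubring ≤ O.toSubring → ∃ (A : Subalgebra k K) (h : A.toSubring ≤ O.toSubring),
        R ≤ A ∧ A.FG ∧ IsFractionRing A K ∧ IsRegularLocalRing (Localization.AtPrime
          (Ideal.comap (Subring.inclusion h) (IsLocalRing.maximalIdeal O)))

/-- `ResPerfect_p`: resolution of every reduced separated scheme of finite type over every
PERFECT field of characteristic `p` (the consequent of the crux at `p`, verbatim). -/
def ResPerfect (p : ℕ) : Prop :=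
  ∀ (k : Type) [Field k] [CharP k p] [PerfectField k] (X : Scheme.{0}) (f : X ⟶ Spec (.of k)),
    IsSeparated f → LocallyOfFiniteType f → QuasiCompact f → IsReduced X → Scheme.HasResolution X

/-- The all-fields antecedent `LUrel_p` of the twin crux `Valuative.PatchingRel` (for §2 (H9), §3 (C3)). -/
def LUrel (p : ℕ) : Prop :=
  ∀ (k K : Type) [Field k] [CharP k p] [Field K] [Algebra k K], (⊤ : IntermediateField k K).FG →
    ∀ O : ValuationSubring K, (∀ c : k, algebraMap k K c ∈ O) → ∀ R : Subalgebra k K, R.FG →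
      R.toSubring ≤ O.toSubring → ∃ (A : Subalgebra k K) (h : A.toSubring ≤ O.toSubring),
        R ≤ A ∧ A.FG ∧ IsFractionRing A K ∧ IsRegularLocalRing (Localization.AtPrime
          (Ideal.comap (Subring.inclusion h) (IsLocalRing.maximalIdeal O)))

/-- The crux is `∀ p prime, LUrelPerfect_p → ResPerfect_p` (definitional). -/
theorem patchingRelPerfect_iff :
    DefectlessFrames.PatchingRelPerfect ↔ ∀ p : ℕ, p.Prime → LUrelPerfect p → ResPerfect p :=
  Iff.rfl

/-- The seven route copies of the crux are ONE term (dedup by normalised signature). -/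
theorem copies_are_one_term :
    (ShadowGame.PatchingRelPerfect ↔ DefectlessFrames.PatchingRelPerfect) ∧
    (FrobeniusClosing.PatchingRelPerfect ↔ DefectlessFrames.PatchingRelPerfect) ∧
    (WildCones.PatchingRelPerfect ↔ DefectlessFrames.PatchingRelPerfect) ∧
    (FoliationDescent.PatchingRelPerfect ↔ DefectlessFrames.PatchingRelPerfect) ∧
    (InertialGeneration.PatchingRelPerfect ↔ DefectlessFrames.PatchingRelPerfect) ∧
    (JacobianBudget.PatchingRelPerfect ↔ DefectlessFrames.PatchingRelPerfect) :=
  ⟨Iff.rfl, Iff.rfl, Iff.rfl, Iff.rfl, Iff.rfl, Iff.rfl⟩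

/-- The twin's antecedent restricts to perfect fields: `LUrel_p → LUrelPerfect_p`. -/
theorem lurelPerfect_of_lurel (p : ℕ) (h : LUrel p) : LUrelPerfect p :=
  fun k K _ _ _ _ _ hKfg O hO R hRfg hRO => h k K hKfg O hO R hRfg hRO

/-- Resolution in characteristic `p` (all fields) restricts to perfect fields. -/
theorem resPerfect_of_resolutionInChar (p : ℕ) (h : ResolutionInChar.{0} p) : ResPerfect p :=
  fun k _ _ _ X f hs hl hq hr => h k X f hs hl hq hr

/-! ## §1 Logical position: why the crux resists refutation -/

/-- A valuation ring containing a `k`-subalgebra, as a `k`-subalgebra. -/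
private def oAlg {k K : Type} [Field k] [Field K] [Algebra k K] (O : ValuationSubring K)
    (hO : ∀ c : k, algebraMap k K c ∈ O) : Subalgebra k K :=
  { O.toSubring with algebraMap_mem' := hO }

/-- **The converse of the crux holds FIBREWISE**: resolution over perfect fields of
characteristic `p` gives relative local uniformization over perfect fields of characteristic
`p` — enlarge the prescribed `R` by an affine model `A₀ ⊆ O` of `K` (`exists_affineModel`),
resolve `Spec (R ⊔ A₀)` (a reduced affine `k`-scheme of finite type over the SAME perfect `k`) and
lift `Spec O` to the resolution by the valuative criterion
(`exists_affineModel_regular_of_hasResolution`). So the crux makes `LUrelPerfect_p ↔ ResPerfect_p`.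
[folklore] -/
theorem lurelPerfect_of_resPerfect (p : ℕ) (h : ResPerfect p) : LUrelPerfect p := by
  intro k K _ _ _ _ _ hKfg O hO R hRfg hRO
  obtain ⟨A₀, hA₀O, hA₀fg, hA₀fr⟩ := exists_affineModel k K hKfg O hO
  have hR'O : (R ⊔ A₀).toSubring ≤ O.toSubring := by
    change R ⊔ A₀ ≤ oAlg O hO
    exact sup_le (fun x hx => hRO hx) (fun x hx => hA₀O hx)
  have hR'fg : (R ⊔ A₀).FG := hRfg.sup hA₀fg
  have hR'fr : IsFractionRing ↥(R ⊔ A₀) K := isFractionRing_of_le le_sup_right hA₀fr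
  haveI : Algebra.FiniteType k ↥(R ⊔ A₀) := (R ⊔ A₀).fg_iff_finiteType.mp hR'fg
  have hres : Scheme.HasResolution (Spec (.of ↥(R ⊔ A₀))) := by
    let f : Spec (.of ↥(R ⊔ A₀)) ⟶ Spec (.of k) :=
      Spec.map (CommRingCat.ofHom (algebraMap k ↥(R ⊔ A₀)))
    haveI : LocallyOfFiniteType f :=
      (HasRingHomProperty.Spec_iff (P := @LocallyOfFiniteType)).mpr
        (RingHom.finiteType_algebraMap.mpr ‹_›)
    exact h k (Spec (.of ↥(R ⊔ A₀))) f inferInstance inferInstance inferInstance inferInstance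
  obtain ⟨A, hA, hle, hAfg, hreg⟩ :=
    exists_affineModel_regular_of_hasResolution O (R ⊔ A₀) hR'O hR'fg hR'fr hres
  exact ⟨A, hA, le_sup_left.trans hle, hAfg, isFractionRing_of_le hle hR'fr, hreg⟩

/-- **Why it resists**: a refutation of the crux is exactly a prime `p` at which local
uniformization over perfect fields HOLDS and resolution over some perfect field FAILS. -/
theorem not_patchingRelPerfect_iff :
    ¬ DefectlessFrames.PatchingRelPerfect ↔ ∃ p : ℕ, p.Prime ∧ LUrelPerfect p ∧ ¬ ResPerfect p := by
  constructor
  · intro h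
    by_contra h'
    exact h fun p hp hLU => by_contra fun hR => h' ⟨p, hp, hLU, hR⟩
  · rintro ⟨p, hp, hLU, hR⟩ h
    exact hR (h p hp hLU)

/-- Resolution over perfect fields in every prime characteristic is `(∀ p prime, LUrelPerfect_p) ∧
PatchingRelPerfect`: the crux is the exact complement of local uniformization inside the
perfect-field slice of the summit. -/
theorem summitPerfect_iff :
    (∀ p : ℕ, p.Prime → ResPerfect p) ↔
      (∀ p : ℕ, p.Prime → LUrelPerfect p) ∧ DefectlessFrames.PatchingRelPerfect :=
  ⟨fun h => ⟨fun p hp => lurelPerfect_of_resPerfect p (h p hp), fun p hp _ => h p hp⟩,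
    fun ⟨hLU, hP⟩ p hp => hP p hp (hLU p hp)⟩

/-- In particular the crux follows from the summit (it is not stronger than the problem). -/
theorem patchingRelPerfect_of_summit (h : _root_.ResolutionOfSingularities) :
    DefectlessFrames.PatchingRelPerfect :=
  fun p hp _ => resPerfect_of_resolutionInChar p (h p hp)

/-- Under local uniformization over perfect fields (believed in every characteristic; a theorem
in transcendence degree `≤ 3`, §4) the crux IS resolution over perfect fields: nothing weaker
discharges it. -/
theorem patchingRelPerfect_iff_resPerfect_of_lurelPerfect (hLU : ∀ p : ℕ, p.Prime → LUrelPerfect p) :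
    DefectlessFrames.PatchingRelPerfect ↔ ∀ p : ℕ, p.Prime → ResPerfect p :=
  ⟨fun h p hp => h p hp (hLU p hp), fun h p hp _ => h p hp⟩

/-! ## §2 Load-bearing analysis of the antecedent -/

/-- (H1) The crux over ALL `p : ℕ` (primality dropped). -/
def PatchingRelPerfectAllChar : Prop := ∀ p : ℕ, LUrelPerfect p → ResPerfect p

/-- (H1) `p.Prime` is not load-bearing: composite non-zero `p` admits no field of characteristic
`p` (both sides vacuous), and `p = 0` is Hironaka's theorem (named fact `Hironaka1964`). -/
theorem patchingRelPerfectAllChar_iff (h0 : Hironaka1964.{0}) :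
    PatchingRelPerfectAllChar ↔ DefectlessFrames.PatchingRelPerfect := by
  refine ⟨fun h p _ => h p, fun h p hLU => ?_⟩
  by_cases hp : p.Prime
  · exact h p hp hLU
  · rcases Nat.eq_zero_or_pos p with rfl | hpos
    · exact resPerfect_of_resolutionInChar 0 h0
    · intro k _ _ _ X f _ _ _ _
      exfalso
      rcases CharP.char_is_prime_or_zero k p with h' | h'
      · exact hp h'
      · omega

/-- (H2) The antecedent with `k ⊆ O` dropped. -/
def LUrelPerfectNoConst (p : ℕ) : Prop :=
  ∀ (k K : Type) [Field k] [CharP k p] [PerfectField k] [Field K] [Algebra k K],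
    (⊤ : IntermediateField k K).FG →
    ∀ O : ValuationSubring K, ∀ R : Subalgebra k K, R.FG →
      R.toSubring ≤ O.toSubring → ∃ (A : Subalgebra k K) (h : A.toSubring ≤ O.toSubring),
        R ≤ A ∧ A.FG ∧ IsFractionRing A K ∧ IsRegularLocalRing (Localization.AtPrime
          (Ideal.comap (Subring.inclusion h) (IsLocalRing.maximalIdeal O)))

/-- (H2) `k ⊆ O` is redundant: it follows from `R ⊆ O` since `R` is a `k`-subalgebra. -/
theorem lurelPerfectNoConst_iff (p : ℕ) : LUrelPerfectNoConst p ↔ LUrelPerfect p :=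
  ⟨fun h k K _ _ _ _ _ hfg O _ R hR hRO => h k K hfg O R hR hRO,
    fun h k K _ _ _ _ _ hfg O R hR hRO => h k K hfg O (fun c => hRO (R.algebraMap_mem c)) R hR hRO⟩

/-- (H3) The antecedent with finite generation of `K/k` dropped. -/
def LUrelPerfectNoFG (p : ℕ) : Prop :=
  ∀ (k K : Type) [Field k] [CharP k p] [PerfectField k] [Field K] [Algebra k K],
    ∀ O : ValuationSubring K, (∀ c : k, algebraMap k K c ∈ O) → ∀ R : Subalgebra k K, R.FG →
      R.toSubring ≤ O.toSubring → ∃ (A : Subalgebra k K) (h : A.toSubring ≤ O.toSubring),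
        R ≤ A ∧ A.FG ∧ IsFractionRing A K ∧ IsRegularLocalRing (Localization.AtPrime
          (Ideal.comap (Subring.inclusion h) (IsLocalRing.maximalIdeal O)))

/-- (H3) Without finite generation of `K/k` the antecedent is FALSE already over the perfect
field `𝔽_p`: `𝔽_p^alg / 𝔽_p` has no affine model (tree
`not_exists_fg_isFractionRing_algebraicClosure`; witness `O = ⊤`, `R = ⊥`) … -/
theorem not_lurelPerfectNoFG (p : ℕ) (hp : p.Prime) : ¬ LUrelPerfectNoFG p := by
  haveI : Fact p.Prime := ⟨hp⟩
  intro h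
  obtain ⟨A, -, -, hfg, hfr, -⟩ := h (ZMod p) (AlgebraicClosure (ZMod p)) ⊤
    (fun c => ValuationSubring.mem_top _) ⊥ Subalgebra.fg_bot (fun x _ => trivial)
  exact not_exists_fg_isFractionRing_algebraicClosure p ⟨A, hfg, hfr⟩

/-- (H3) … so the crux with that antecedent is VACUOUSLY true — a trap: it proves nothing about
resolution. -/
theorem patchingRelPerfectNoFG_holds : ∀ p : ℕ, p.Prime → LUrelPerfectNoFG p → ResPerfect p :=
  fun p hp h => absurd h (not_lurelPerfectNoFG p hp)

/-- (H4) The antecedent with `IsFractionRing A K` dropped from its conclusion. -/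
def LUrelPerfectNoFrac (p : ℕ) : Prop :=
  ∀ (k K : Type) [Field k] [CharP k p] [PerfectField k] [Field K] [Algebra k K],
    (⊤ : IntermediateField k K).FG →
    ∀ O : ValuationSubring K, (∀ c : k, algebraMap k K c ∈ O) → ∀ R : Subalgebra k K, R.FG →
      R.toSubring ≤ O.toSubring → ∃ (A : Subalgebra k K) (h : A.toSubring ≤ O.toSubring),
        R ≤ A ∧ A.FG ∧ IsRegularLocalRing (Localization.AtPrime
          (Ideal.comap (Subring.inclusion h) (IsLocalRing.maximalIdeal O)))

/-- (H4) **`IsFractionRing A K` is redundant** in the antecedent: enlarge the prescribed `R` by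
an affine model `A₀ ⊆ O` of `K` before uniformizing; any `A ⊇ R ⊔ A₀` has fraction field `K`. -/
theorem lurelPerfectNoFrac_iff (p : ℕ) : LUrelPerfectNoFrac p ↔ LUrelPerfect p := by
  refine ⟨fun h k K _ _ _ _ _ hKfg O hO R hRfg hRO => ?_,
    fun h k K _ _ _ _ _ hKfg O hO R hRfg hRO => ?_⟩
  · obtain ⟨A₀, hA₀O, hA₀fg, hA₀fr⟩ := exists_affineModel k K hKfg O hO
    have hR'O : (R ⊔ A₀).toSubring ≤ O.toSubring := by
      change R ⊔ A₀ ≤ oAlg O hO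
      exact sup_le (fun x hx => hRO hx) (fun x hx => hA₀O hx)
    have hR'fr : IsFractionRing ↥(R ⊔ A₀) K := isFractionRing_of_le le_sup_right hA₀fr
    obtain ⟨A, hA, hle, hAfg, hreg⟩ := h k K hKfg O hO (R ⊔ A₀) (hRfg.sup hA₀fg) hR'O
    exact ⟨A, hA, le_sup_left.trans hle, hAfg, isFractionRing_of_le hle hR'fr, hreg⟩
  · obtain ⟨A, hA, hle, hAfg, -, hreg⟩ := h k K hKfg O hO R hRfg hRO
    exact ⟨A, hA, hle, hAfg, hreg⟩

/-- (H5) The antecedent with finite generation of the PRESCRIBED algebra `R` dropped. -/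
def LUrelPerfectNoRFG (p : ℕ) : Prop :=
  ∀ (k K : Type) [Field k] [CharP k p] [PerfectField k] [Field K] [Algebra k K],
    (⊤ : IntermediateField k K).FG → ∀ O : ValuationSubring K,
      (∀ c : k, algebraMap k K c ∈ O) → ∀ R : Subalgebra k K, R.toSubring ≤ O.toSubring →
        ∃ (A : Subalgebra k K) (h : A.toSubring ≤ O.toSubring), R ≤ A ∧ A.FG ∧
          IsFractionRing A K ∧ IsRegularLocalRing (Localization.AtPrime
            (Ideal.comap (Subring.inclusion h) (IsLocalRing.maximalIdeal O)))

/-- (H5) **`R.FG` is load-bearing for the antecedent**: demanded for ALL `k`-subalgebras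
`R ⊆ O`, local uniformization fails already over the perfect field `𝔽_p` (witness `K = 𝔽_p(X)`,
`O = K`, `R = K`: a finitely generated `A ⊇ K` would make `𝔽_p(X)` a finitely generated
`𝔽_p`-algebra, contradicting Zariski's lemma; the twin's tree theorem `not_lurel_without_rfg`
run at `k = 𝔽_p`) … -/
theorem not_lurelPerfectNoRFG (p : ℕ) (hp : p.Prime) : ¬ LUrelPerfectNoRFG p := by
  intro h
  haveI : Fact p.Prime := ⟨hp⟩
  obtain ⟨A, -, hle, hAfg, -, -⟩ := h (ZMod p) (FractionRing (Polynomial (ZMod p)))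
    (IntermediateField.fg_top_iff.mpr
      (Algebra.EssFiniteType.comp (ZMod p) (Polynomial (ZMod p)) _))
    ⊤ (fun _ => ValuationSubring.mem_top _) ⊤ (fun _ _ => ValuationSubring.mem_top _)
  have htop : (⊤ : Subalgebra (ZMod p) (FractionRing (Polynomial (ZMod p)))).FG := by
    rwa [← eq_top_iff.mpr hle]
  haveI : Algebra.FiniteType (ZMod p) (FractionRing (Polynomial (ZMod p))) := ⟨htop⟩
  haveI : Module.Finite (ZMod p) (FractionRing (Polynomial (ZMod p))) :=
    finite_of_finite_type_of_isJacobsonRing (ZMod p) _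
  have hT : Transcendental (ZMod p)
      (algebraMap (Polynomial (ZMod p)) (FractionRing (Polynomial (ZMod p))) Polynomial.X) :=
    (transcendental_algebraMap_iff (IsFractionRing.injective (Polynomial (ZMod p)) _)).mpr
      (Polynomial.transcendental_X (ZMod p))
  exact hT (Algebra.IsAlgebraic.isAlgebraic _)

/-- (H5) … so the crux with that antecedent holds VACUOUSLY — a second trap. -/
theorem patchingRelPerfectNoRFG_holds : ∀ p : ℕ, p.Prime → LUrelPerfectNoRFG p → ResPerfect p :=
  fun p hp h => absurd h (not_lurelPerfectNoRFG p hp)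

/-- (H6) The antecedent with REGULARITY AT THE CENTRE dropped. -/
def LUrelPerfectNoReg (p : ℕ) : Prop :=
  ∀ (k K : Type) [Field k] [CharP k p] [PerfectField k] [Field K] [Algebra k K],
    (⊤ : IntermediateField k K).FG →
    ∀ O : ValuationSubring K, (∀ c : k, algebraMap k K c ∈ O) → ∀ R : Subalgebra k K, R.FG →
      R.toSubring ≤ O.toSubring → ∃ (A : Subalgebra k K) (_ : A.toSubring ≤ O.toSubring),
        R ≤ A ∧ A.FG ∧ IsFractionRing A K

/-- (H6) Without regularity the antecedent is a triviality (`A = R ⊔ A₀`, `A₀` an affine model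
of `K` inside `O`) … -/
theorem lurelPerfectNoReg_holds (p : ℕ) : LUrelPerfectNoReg p := by
  intro k K _ _ _ _ _ hKfg O hO R hRfg hRO
  obtain ⟨A₀, hA₀O, hA₀fg, hA₀fr⟩ := exists_affineModel k K hKfg O hO
  have hR'O : (R ⊔ A₀).toSubring ≤ O.toSubring := by
    change R ⊔ A₀ ≤ oAlg O hO
    exact sup_le (fun x hx => hRO hx) (fun x hx => hA₀O hx)
  exact ⟨R ⊔ A₀, hR'O, le_sup_left, hRfg.sup hA₀fg, isFractionRing_of_le le_sup_right hA₀fr⟩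

/-- (H6) … so the crux with regularity dropped from its antecedent IS resolution over perfect
fields: regularity at the centre is the entire content of the hypothesis. -/
theorem patchingRelPerfectNoReg_iff :
    (∀ p : ℕ, p.Prime → LUrelPerfectNoReg p → ResPerfect p) ↔ ∀ p : ℕ, p.Prime → ResPerfect p :=
  ⟨fun h p hp => h p hp (lurelPerfectNoReg_holds p), fun h p hp _ => h p hp⟩

/-- (H7) **The antecedent is free on valuation rings essentially of finite type** (tree
`lurel_of_essFiniteType`): if `O` is a localisation of a finitely generated `k`-subalgebra
`B ⊆ O` (e.g. `O` DIVISORIAL, or `O = K`), then `A := R ⊔ B` answers the antecedent at `O` —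
its localisation at the centre is `O` itself, a Noetherian valuation ring. So THE HYPOTHESIS HAS
CONTENT ONLY AT VALUATION RINGS THAT ARE NOT ESSENTIALLY OF FINITE TYPE over `k`; a proof of the
crux feeding its hypothesis only divisorial valuations proves `ResPerfect_p` from nothing. -/
theorem lurelPerfect_free_at_essFiniteType {k K : Type} [Field k] [Field K] [Algebra k K]
    (O : ValuationSubring K) (B : Subalgebra k K) (hBfg : B.FG) (hBO : B.toSubring ≤ O.toSubring)
    (hloc : ∀ x : K, x ∈ O → ∃ b ∈ B, ∃ s ∈ B, s ≠ 0 ∧ s⁻¹ ∈ O ∧ x = b * s⁻¹)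
    (R : Subalgebra k K) (hRfg : R.FG) (hRO : R.toSubring ≤ O.toSubring) :
    ∃ (A : Subalgebra k K) (h : A.toSubring ≤ O.toSubring), R ≤ A ∧ A.FG ∧
      IsRegularLocalRing (Localization.AtPrime
        (Ideal.comap (Subring.inclusion h) (IsLocalRing.maximalIdeal O))) := by
  obtain ⟨A, h, hRA, -, hAfg, hreg⟩ := lurel_of_essFiniteType O B hBfg hBO hloc R hRfg hRO
  exact ⟨A, h, hRA, hAfg, hreg⟩

/-- (H7′) The TRIVIAL valuation `O = K` (the junk model every refuter tries first) is an
instance of (H7): the antecedent holds at `O = ⊤` with all conjuncts, uniformly in `p` and the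
dimension, perfectness unused. -/
theorem lurelPerfect_at_top {k K : Type} [Field k] [Field K] [Algebra k K]
    (hKfg : (⊤ : IntermediateField k K).FG) (R : Subalgebra k K) (hRfg : R.FG) :
    ∃ (A : Subalgebra k K) (h : A.toSubring ≤ (⊤ : ValuationSubring K).toSubring), R ≤ A ∧ A.FG ∧
      IsFractionRing A K ∧ IsRegularLocalRing (Localization.AtPrime
        (Ideal.comap (Subring.inclusion h)
          (IsLocalRing.maximalIdeal (⊤ : ValuationSubring K)))) := by
  obtain ⟨A₀, -, hA₀fg, hA₀fr⟩ :=
    exists_affineModel k K hKfg ⊤ (fun c => ValuationSubring.mem_top _)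
  have hloc : ∀ x : K, x ∈ (⊤ : ValuationSubring K) → ∃ b ∈ A₀, ∃ s ∈ A₀, s ≠ 0 ∧
      s⁻¹ ∈ (⊤ : ValuationSubring K) ∧ x = b * s⁻¹ := by
    intro x _
    obtain ⟨a, s, hs, rfl⟩ := IsFractionRing.div_surjective (A := A₀) x
    refine ⟨a, a.2, s, s.2, ?_, ValuationSubring.mem_top _, by rw [div_eq_mul_inv]; rfl⟩
    intro h0
    exact nonZeroDivisors.ne_zero hs (Subtype.ext h0)
  obtain ⟨A, h, hRA, hA₀A, hAfg, hreg⟩ := lurel_of_essFiniteType ⊤ A₀ hA₀fg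
    (fun _ _ => ValuationSubring.mem_top _) hloc R hRfg (fun _ _ => ValuationSubring.mem_top _)
  exact ⟨A, h, hRA, hAfg, isFractionRing_of_le hA₀A hA₀fr, hreg⟩

/-- (H8) The antecedent restricted to ZERO-DIMENSIONAL valuation rings (residue field algebraic
over `k`) — the closed points of `Zar(K/k)`; verbatim the antecedent of this route's
`ResidueTranscendenceReduction` with the rank-one clause removed. -/
def LUrelPerfectZeroDim (p : ℕ) : Prop :=
  ∀ (k K : Type) [Field k] [CharP k p] [PerfectField k] [Field K] [Algebra k K],
    (⊤ : IntermediateField k K).FG →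
    ∀ O : ValuationSubring K, (∀ c : k, algebraMap k K c ∈ O) →
      (∀ x ∈ O, ∃ f : Polynomial k, f ≠ 0 ∧ Polynomial.aeval x f ∈ O.nonunits) →
      ∀ R : Subalgebra k K, R.FG → R.toSubring ≤ O.toSubring →
      ∃ (A : Subalgebra k K) (h : A.toSubring ≤ O.toSubring),
        R ≤ A ∧ A.FG ∧ IsFractionRing A K ∧ IsRegularLocalRing (Localization.AtPrime
          (Ideal.comap (Subring.inclusion h) (IsLocalRing.maximalIdeal O)))

/-- (H8) **LU at ZERO-DIMENSIONAL valuations suffices** — `LUrelPerfectZeroDim_p ↔ LUrelPerfect_p`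
(tree `relLU_of_relLU_zeroDim`: refine `O` to a closed point of `Zar(K/R)` below it, uniformize
there, descend regularity to the coarsening by Serre). -/
theorem lurelPerfectZeroDim_iff (p : ℕ) : LUrelPerfectZeroDim p ↔ LUrelPerfect p :=
  ⟨fun h k K _ _ _ _ _ hKfg O _ R hRfg hRO => relLU_of_relLU_zeroDim (h k K hKfg) O R hRfg hRO,
    fun h k K _ _ _ _ _ hKfg O hO _ R hRfg hRO => h k K hKfg O hO R hRfg hRO⟩

/-- (H8) Hence the crux with the zero-dimensional antecedent is THE SAME statement. -/
theorem patchingRelPerfectZeroDim_iff :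
    (∀ p : ℕ, p.Prime → LUrelPerfectZeroDim p → ResPerfect p) ↔ DefectlessFrames.PatchingRelPerfect :=
  ⟨fun h p hp hLU => h p hp ((lurelPerfectZeroDim_iff p).mpr hLU),
    fun h p hp hLU => h p hp ((lurelPerfectZeroDim_iff p).mp hLU)⟩

/-- (H8c) **PERFECT-SPECIFIC: the antecedent is FREE at ABHYANKAR places** (equality in
Abhyankar's inequality; Knaf–Kuhlmann 2005 Thm. 1.1 + Cor. 2.2, PROVED in the tree; over a
perfect ground field the residue extension of an Abhyankar place is automatically separably
generated — tree `relLU_at_abhyankarPlace_of_perfectField`). -/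
theorem lurelPerfect_free_at_abhyankarPlace {k K : Type} [Field k] [PerfectField k] [Field K]
    [Algebra k K] (hKfg : (⊤ : IntermediateField k K).FG) (O : ValuationSubring K)
    (hO : ∀ c : k, algebraMap k K c ∈ O)
    (hAbh : IsAbhyankarPlace O (algebraMap k K).fieldRange ⊤)
    (R : Subalgebra k K) (hRfg : R.FG) (hRO : R.toSubring ≤ O.toSubring) :
    ∃ (A : Subalgebra k K) (h : A.toSubring ≤ O.toSubring), R ≤ A ∧ A.FG ∧ IsFractionRing A K ∧
      IsRegularLocalRing (Localization.AtPrime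
        (Ideal.comap (Subring.inclusion h) (IsLocalRing.maximalIdeal O))) :=
  relLU_at_abhyankarPlace_of_perfectField hKfg O hO hAbh R hRfg hRO

/-- (H8c) The HARD CORE of the antecedent: LU demanded only at valuation rings that are
ZERO-DIMENSIONAL and NOT Abhyankar places (positive defect in Abhyankar's inequality). -/
def LUrelPerfectHard (p : ℕ) : Prop :=
  ∀ (k K : Type) [Field k] [CharP k p] [PerfectField k] [Field K] [Algebra k K],
    (⊤ : IntermediateField k K).FG →
    ∀ O : ValuationSubring K, (∀ c : k, algebraMap k K c ∈ O) →
      (∀ x ∈ O, ∃ f : Polynomial k, f ≠ 0 ∧ Polynomial.aeval x f ∈ O.nonunits) →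
      ¬ IsAbhyankarPlace O (algebraMap k K).fieldRange ⊤ →
      ∀ R : Subalgebra k K, R.FG → R.toSubring ≤ O.toSubring →
      ∃ (A : Subalgebra k K) (h : A.toSubring ≤ O.toSubring),
        R ≤ A ∧ A.FG ∧ IsFractionRing A K ∧ IsRegularLocalRing (Localization.AtPrime
          (Ideal.comap (Subring.inclusion h) (IsLocalRing.maximalIdeal O)))

/-- (H8c) **The antecedent is equivalent to its hard core**: `LUrelPerfectHard_p ↔ LUrelPerfect_p`
— refine to a closed point below `O`; an Abhyankar place is uniformized for free
(Knaf–Kuhlmann), a non-Abhyankar one by hypothesis; descend by Serre. So a proof of the crux may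
assume its hypothesis is fed exactly Kuhlmann's defect / rank-deficient zero-dimensional
valuations, and a refutation would have to PROVE LU precisely there. -/
theorem lurelPerfectHard_iff (p : ℕ) : LUrelPerfectHard p ↔ LUrelPerfect p := by
  refine ⟨fun h k K _ _ _ _ _ hKfg O hO R hRfg hRO => ?_,
    fun h k K _ _ _ _ _ hKfg O hO _ _ R hRfg hRO => h k K hKfg O hO R hRfg hRO⟩
  obtain ⟨O', hO'O, hRO', hmin⟩ := exists_minimal_valuationSubring_le R O hRO
  have hO' : ∀ c : k, algebraMap k K c ∈ O' := fun c => hRO' (R.algebraMap_mem c)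
  by_cases hAbh : IsAbhyankarPlace O' (algebraMap k K).fieldRange ⊤
  · obtain ⟨A, hA, hRA, hAfg, hfr, hreg⟩ :=
      lurelPerfect_free_at_abhyankarPlace hKfg O' hO' hAbh R hRfg hRO'
    exact ⟨A, fun x hx => hO'O (hA hx), hRA, hAfg, hfr,
      isRegularLocalRing_centre_of_le A hO'O hA _ hreg⟩
  · obtain ⟨A, hA, hRA, hAfg, hfr, hreg⟩ := h k K hKfg O' hO'
      (exists_aeval_mem_nonunits_of_minimal R hRfg O' hRO' hmin) hAbh R hRfg hRO'
    exact ⟨A, fun x hx => hO'O (hA hx), hRA, hAfg, hfr,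
      isRegularLocalRing_centre_of_le A hO'O hA _ hreg⟩

/-- (H8c) Hence the crux with the HARD-CORE antecedent is THE SAME statement. -/
theorem patchingRelPerfect_iff_hard :
    DefectlessFrames.PatchingRelPerfect ↔ ∀ p : ℕ, p.Prime → LUrelPerfectHard p → ResPerfect p :=
  ⟨fun h p hp hLU => h p hp ((lurelPerfectHard_iff p).mp hLU),
    fun h p hp hLU => h p hp ((lurelPerfectHard_iff p).mpr hLU)⟩

/-- (H9) `[PerfectField k]` dropped from the ANTECEDENT: the "weak twin" `LUrel_p → ResPerfect_p`
follows from the crux (and from the twin `PatchingRel`), so it is irrefutable short of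
`¬ ResPerfect_p`; it is NOT known to give the crux back (that would be LU-ascent from perfect to
arbitrary ground fields, cf. `DescentPerfectToAll`). -/
theorem weakTwin_of_patchingRelPerfect (h : DefectlessFrames.PatchingRelPerfect) :
    ∀ p : ℕ, p.Prime → LUrel p → ResPerfect p :=
  fun p hp hLU => h p hp (lurelPerfect_of_lurel p hLU)

/-! ## §3 Consequent mutations -/

/-- (C1) The consequent with `IsReduced X` dropped. -/
def ResPerfectNoReduced (p : ℕ) : Prop :=
  ∀ (k : Type) [Field k] [CharP k p] [PerfectField k] (X : Scheme.{0}) (f : X ⟶ Spec (.of k)),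
    IsSeparated f → LocallyOfFiniteType f → QuasiCompact f → Scheme.HasResolution X

/-- (C1) **`IsReduced` is load-bearing in the consequent, already over the perfect field `𝔽_p`**:
`Spec 𝔽_p[ε] → Spec 𝔽_p` is affine (separated, quasi-compact) of finite type and has no
resolution — the stalk at a point of the dense open would be regular, hence a domain, but `ε/1`
is a non-zero nilpotent (tree `not_hasResolution_spec_dualNumber`). [folklore] -/
theorem not_resPerfectNoReduced (p : ℕ) (hp : p.Prime) : ¬ ResPerfectNoReduced p := by
  haveI : Fact p.Prime := ⟨hp⟩
  intro h
  haveI : Module.Finite (ZMod p) (DualNumber (ZMod p)) :=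
    inferInstanceAs (Module.Finite (ZMod p) (ZMod p × ZMod p))
  let f : Spec (.of (DualNumber (ZMod p))) ⟶ Spec (.of (ZMod p)) :=
    Spec.map (CommRingCat.ofHom (algebraMap (ZMod p) (DualNumber (ZMod p))))
  haveI : LocallyOfFiniteType f :=
    (HasRingHomProperty.Spec_iff (P := @LocallyOfFiniteType)).mpr
      (RingHom.finiteType_algebraMap.mpr inferInstance)
  exact not_hasResolution_spec_dualNumber (ZMod p)
    (h (ZMod p) (Spec (.of (DualNumber (ZMod p)))) f inferInstance inferInstance inferInstance)

/-- (C1) Hence the crux with `IsReduced` dropped from its consequent is EQUIVALENT to the failure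
of local uniformization over perfect fields in every prime characteristic (believed false; a
theorem-level refutation would be a proof of LU). -/
theorem patchingRelPerfectNoReduced_iff :
    (∀ p : ℕ, p.Prime → LUrelPerfect p → ResPerfectNoReduced p) ↔
      ∀ p : ℕ, p.Prime → ¬ LUrelPerfect p :=
  ⟨fun h p hp hLU => not_resPerfectNoReduced p hp (h p hp hLU),
    fun h p hp hLU => absurd hLU (h p hp)⟩

/-- (C2) The consequent with `LocallyOfFiniteType f` dropped. -/
def ResPerfectNoFT (p : ℕ) : Prop :=
  ∀ (k : Type) [Field k] [CharP k p] [PerfectField k] (X : Scheme.{0}) (f : X ⟶ Spec (.of k)),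
    IsSeparated f → QuasiCompact f → IsReduced X → Scheme.HasResolution X

/-- (C2) **`LocallyOfFiniteType` is load-bearing in the consequent, already over `𝔽_p`**:
`Spec 𝔽_p[X]⁺ → Spec 𝔽_p` (absolute integral closure of the affine line: affine, reduced) has no
resolution, a root-closed domain being Noetherian at the generic point only (tree
`not_hasResolution_spec_absoluteIntegralClosure`). [folklore] -/
theorem not_resPerfectNoFT (p : ℕ) (hp : p.Prime) : ¬ ResPerfectNoFT p := by
  haveI : Fact p.Prime := ⟨hp⟩
  intro h
  let f : Spec (.of ↥(integralClosure (Polynomial (ZMod p))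
      (AlgebraicClosure (RatFunc (ZMod p))))) ⟶ Spec (.of (ZMod p)) :=
    Spec.map (CommRingCat.ofHom ((algebraMap (Polynomial (ZMod p))
      ↥(integralClosure (Polynomial (ZMod p)) (AlgebraicClosure (RatFunc (ZMod p))))).comp
        Polynomial.C))
  exact not_hasResolution_spec_absoluteIntegralClosure p
    (h (ZMod p) _ f inferInstance inferInstance inferInstance)

/-- (C2) Hence the crux with `LocallyOfFiniteType` dropped from its consequent is again
EQUIVALENT to the failure of LU over perfect fields in every prime characteristic. -/
theorem patchingRelPerfectNoFT_iff :
    (∀ p : ℕ, p.Prime → LUrelPerfect p → ResPerfectNoFT p) ↔ ∀ p : ℕ, p.Prime → ¬ LUrelPerfect p :=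
  ⟨fun h p hp hLU => not_resPerfectNoFT p hp (h p hp hLU), fun h p hp hLU => absurd hLU (h p hp)⟩

/-- (C3) `[PerfectField k]` dropped from the CONSEQUENT: the "strong twin"
`LUrelPerfect_p → Res_p` implies the all-fields twin `LUrel_p → Res_p` outright … -/
theorem twin_of_strongTwin (h : ∀ p : ℕ, p.Prime → LUrelPerfect p → ResolutionInChar.{0} p) :
    ∀ p : ℕ, p.Prime → LUrel p → ResolutionInChar.{0} p :=
  fun p hp hLU => h p hp (lurelPerfect_of_lurel p hLU)

/-- (C3) … and follows from the crux together with this route's `DescentPerfectToAll`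
(perfect ⇒ all fields); it is open and not refutable short of `¬ Res_p`. -/
theorem strongTwin_of_patchingRelPerfect_of_descent (h : DefectlessFrames.PatchingRelPerfect)
    (hD : DefectlessFrames.DescentPerfectToAll) :
    ∀ p : ℕ, p.Prime → LUrelPerfect p → ResolutionInChar.{0} p :=
  fun p hp hLU => hD p hp (h p hp hLU)

/-- (C5) Regular schemes are TRUE instances of the consequent (the identity resolves), the empty
scheme included: the consequent has no junk-false instance among regular `X`. -/
theorem resPerfect_of_isRegular {X : Scheme.{0}} (hX : Scheme.IsRegular X) :
    Scheme.HasResolution X :=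
  hX.hasResolution

/-! ## §4 The dimension slice (mod `CossartPiltant2019`) -/

/-- **The antecedent is free in transcendence degree `≤ 3`** over every field (so over perfect
ones), modulo `CossartPiltant2019` (twin's tree theorem `lurel_trdeg_le_three`). -/
theorem lurelPerfect_trdeg_le_three (h : CossartPiltant2019.{0}) {k K : Type} [Field k] [Field K]
    [Algebra k K] (hKfg : (⊤ : IntermediateField k K).FG) (hK : Algebra.trdeg k K ≤ 3)
    (O : ValuationSubring K) (hO : ∀ c : k, algebraMap k K c ∈ O) (R : Subalgebra k K)
    (hRfg : R.FG) (hRO : R.toSubring ≤ O.toSubring) :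
    ∃ (A : Subalgebra k K) (h : A.toSubring ≤ O.toSubring), R ≤ A ∧ A.FG ∧ IsFractionRing A K ∧
      IsRegularLocalRing (Localization.AtPrime
        (Ideal.comap (Subring.inclusion h) (IsLocalRing.maximalIdeal O))) :=
  Theorems.PatchingRel.Negative.lurel_trdeg_le_three h hKfg hK O hO R hRfg hRO

/-- The antecedent restricted to transcendence degree `≥ 4`. -/
def LUrelPerfectTrdegGe4 (p : ℕ) : Prop :=
  ∀ (k K : Type) [Field k] [CharP k p] [PerfectField k] [Field K] [Algebra k K],
    (⊤ : IntermediateField k K).FG → ¬ Algebra.trdeg k K ≤ 3 →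
    ∀ O : ValuationSubring K, (∀ c : k, algebraMap k K c ∈ O) → ∀ R : Subalgebra k K, R.FG →
      R.toSubring ≤ O.toSubring → ∃ (A : Subalgebra k K) (h : A.toSubring ≤ O.toSubring),
        R ≤ A ∧ A.FG ∧ IsFractionRing A K ∧ IsRegularLocalRing (Localization.AtPrime
          (Ideal.comap (Subring.inclusion h) (IsLocalRing.maximalIdeal O)))

/-- The consequent restricted to dimension `≥ 4`. -/
def ResPerfectDimGe4 (p : ℕ) : Prop :=
  ∀ (k : Type) [Field k] [CharP k p] [PerfectField k] (X : Scheme.{0}) (f : X ⟶ Spec (.of k)),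
    IsSeparated f → LocallyOfFiniteType f → QuasiCompact f → IsReduced X →
      ¬ topologicalKrullDim X ≤ 3 → Scheme.HasResolution X

/-- Modulo `CossartPiltant2019`, the high-transcendence-degree antecedent is the full one. -/
theorem lurelPerfectTrdegGe4_iff (h : CossartPiltant2019.{0}) (p : ℕ) :
    LUrelPerfectTrdegGe4 p ↔ LUrelPerfect p := by
  refine ⟨fun H k K _ _ _ _ _ hKfg O hO R hRfg hRO => ?_,
    fun H k K _ _ _ _ _ hKfg _ O hO R hRfg hRO => H k K hKfg O hO R hRfg hRO⟩
  by_cases hK : Algebra.trdeg k K ≤ 3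
  · exact lurelPerfect_trdeg_le_three h hKfg hK O hO R hRfg hRO
  · exact H k K hKfg hK O hO R hRfg hRO

/-- Modulo `CossartPiltant2019`, resolution over perfect fields in dimension `≥ 4` is the full
consequent (dimension `≤ 3` is the named fact, `hasResolution_of_dim_le_three`). -/
theorem resPerfectDimGe4_iff (h : CossartPiltant2019.{0}) (p : ℕ) :
    ResPerfectDimGe4 p ↔ ResPerfect p := by
  refine ⟨fun H k _ _ _ X f hsep hft hqc hred => ?_,
    fun H k _ _ _ X f hsep hft hqc hred _ => H k X f hsep hft hqc hred⟩
  by_cases hd : topologicalKrullDim X ≤ 3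
  · haveI := hsep; haveI := hft; haveI := hqc; haveI := hred
    exact hasResolution_of_dim_le_three h k X f hd
  · exact H k X f hsep hft hqc hred hd

/-- **The crux is its high-dimensional slice** (modulo `CossartPiltant2019`):
`PatchingRelPerfect ↔ ∀ p prime, LUrelPerfectTrdegGe4_p → ResPerfectDimGe4_p`. A refutation needs
local uniformization over a perfect field for some function field of transcendence degree `≥ 4`
feeding a fourfold (or more) over a perfect field without resolution; a proof gains nothing from
the dimension-`≤ 3` theorems. -/
theorem patchingRelPerfect_iff_highDim (h : CossartPiltant2019.{0}) :
    DefectlessFrames.PatchingRelPerfect ↔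
      ∀ p : ℕ, p.Prime → LUrelPerfectTrdegGe4 p → ResPerfectDimGe4 p :=
  ⟨fun H p hp hLU => (resPerfectDimGe4_iff h p).mpr (H p hp ((lurelPerfectTrdegGe4_iff h p).mp hLU)),
    fun H p hp hLU => (resPerfectDimGe4_iff h p).mp (H p hp ((lurelPerfectTrdegGe4_iff h p).mpr hLU))⟩

/-! ## §5 Targets (line `birth`: `stub_sandwichedOfLU`, `stub_patchingOfSandwiched`)

Payload targets: none this cycle. Both stub conclusions (`SandwichedLocusPerfect p`,
`TwoModelPatchingPerfect p`, defined in `Cruxes/PatchingRelPerfect/Lines/birth.lean`) are proved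
THERE to follow from `ResPerfect p` (`sandwichedLocusPerfect_of_resPerfect`,
`twoModelPatchingPerfect_of_resPerfect`, kernel-checked in the registered skeleton, sha
67ecc309…), so neither stub is refutable short of `¬ ResPerfect_p` for some prime `p`, i.e. short
of a counterexample to resolution over a perfect field — the same wall as §1. The atom
`stub_sandwichedOfLU : RelLUPerfect p → SandwichedLocusPerfect p` has no slack
(`PatchingRelPerfect ↔ Sig.stub_sandwichedOfLU` modulo the paper-true patching stub,
`sig_stub_sandwichedOfLU_of_crux` / `PatchingRelPerfect_of` in the skeleton). No `_false` theorem
is possible here without `¬ ResPerfect`; nothing recorded as killed. -/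

/-! ## §7 Targets, cycle 2 — the registered line `closed-point-slice` (skeleton d35ef396…; stubs
`stub_punctualCompletePerfectFour` [atom], `stub_algebraize`, `stub_dimFourEngine`, `stub_dimGeFive`)

The line's predicates are restated VERBATIM (the line file is a crux work file and cannot be
imported); the theorems of this section that carry no `sorry` are LANDED as
`Theorems/PatchingRelPerfect/Negative/PunctualAtom.lean` (p153213, statements inlined there). -/

/-- VERBATIM `ClosedPointSlice.ResPerfectIntegralDimLeFour` (line `closed-point-slice`). -/
def ResPerfectIntegralDimLeFour (p : ℕ) : Prop :=
  ∀ (k : Type) [Field k] [CharP k p] [PerfectField k] (X : AlgebraicGeometry.Scheme.{0})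
    (f : X ⟶ AlgebraicGeometry.Spec (CommRingCat.of k)), AlgebraicGeometry.IsSeparated f →
    AlgebraicGeometry.LocallyOfFiniteType f → AlgebraicGeometry.QuasiCompact f →
    AlgebraicGeometry.IsIntegral X → topologicalKrullDim X ≤ 4 →
    Literature.AlgebraicGeometry.Resolution.Scheme.HasResolution X

/-- VERBATIM `ClosedPointSlice.ResPerfectIntegralDimGeFive` (line `closed-point-slice`). -/
def ResPerfectIntegralDimGeFive (p : ℕ) : Prop :=
  ∀ (k : Type) [Field k] [CharP k p] [PerfectField k] (X : AlgebraicGeometry.Scheme.{0})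
    (f : X ⟶ AlgebraicGeometry.Spec (CommRingCat.of k)), AlgebraicGeometry.IsSeparated f →
    AlgebraicGeometry.LocallyOfFiniteType f → AlgebraicGeometry.QuasiCompact f →
    AlgebraicGeometry.IsIntegral X → ¬ topologicalKrullDim X ≤ 4 →
    Literature.AlgebraicGeometry.Resolution.Scheme.HasResolution X

/-- VERBATIM `ClosedPointSlice.FibreFreePerfClosed` (line `closed-point-slice`; = ideator 1's
atom of card `perfect-closed-points`). -/
def FibreFreePerfClosed (p n : ℕ) : Prop :=
  ∀ (k : Type) [Field k] [CharP k p] [PerfectField k] (S : Type) [CommRing S] [IsRegularLocalRing S]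
    [Algebra k S] [Algebra.EssFiniteType k S], ringKrullDim S ≤ n →
    Module.Finite k (S ⧸ IsLocalRing.maximalIdeal S) →
    ∀ (T : Scheme.{0}) (f : T ⟶ Spec (.of S)), IsIntegral T → IsProper f → IsBirational f →
    (∀ t : T, f.base t ≠ IsLocalRing.closedPoint S → IsRegularLocalRing (T.presheaf.stalk t)) →
    ∃ (T' : Scheme.{0}) (π : T' ⟶ T), IsResolution π ∧
      ∃ U : T.Opens, (∀ t : T, t ∈ U ↔ f.base t ≠ IsLocalRing.closedPoint S) ∧ IsIso (π ∣_ U)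

/-- VERBATIM `ClosedPointSlice.PunctualCompletePerfect` (line `closed-point-slice`) — THE ATOM's
predicate: punctual resolution in single-blow-up format over a COMPLETE regular local base of
dimension `≤ n`, equal characteristic `p`, PERFECT residue field. -/
def PunctualCompletePerfect (p n : ℕ) : Prop :=
  ∀ (S : Type) [CommRing S] [IsRegularLocalRing S] [CharP S p]
    [IsAdicComplete (IsLocalRing.maximalIdeal S) S]
    [PerfectField (IsLocalRing.ResidueField S)], ringKrullDim S ≤ n →
    ∀ (T : Scheme.{0}) (f : T ⟶ Spec (.of S)), IsIntegral T → IsProper f → IsBirational f →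
      (∀ t : T, f.base t ≠ IsLocalRing.closedPoint S → IsRegularLocalRing (T.presheaf.stalk t)) →
      ∃ (J : T.IdealSheafData) (T' : Scheme.{0}) (π : T' ⟶ T), J ≠ ⊥ ∧
        (∀ t : T, t ∈ J.support → f.base t = IsLocalRing.closedPoint S) ∧
        IsBlowup π J ∧ Scheme.IsRegular T'

/-! ### §7.1 The three non-atom stubs are irrefutable short of `¬ Res` (recorded, nothing to kill)

* `stub_dimGeFive : RelLUPerfect p → ResPerfectIntegralDimGeFive p` and the conclusion of
  `stub_dimFourEngine` (`ResPerfectIntegralDimLeFour p`) are RESTRICTIONS of `ResPerfect p`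
  (`resPerfectIntegralDimGeFive_of_resPerfect`, `resPerfectIntegralDimLeFour_of_resPerfect`), hence
  consequences of the crux given its antecedent: no `_false` theorem exists short of a
  counterexample to resolution over a perfect field (§1's wall, now in dimension `≥ 5`, resp. `4`).
* `stub_algebraize : PunctualCompletePerfect p 4 → FibreFreePerfClosed p 4`: its conclusion is the
  fibre-free STRONG form (a resolution that is an isomorphism off the closed fibre), which is NOT a
  consequence of the weak `ResPerfect p` as typed — but it is a consequence of strong resolution
  (`π⁻¹(Reg T) ≅ Reg T`, Reg `⊇` off-fibre), printed in dimension `≤ 3` for every residue field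
  (CossartPiltant2019 Thm. 1.1 (ii)) and expected in all dimensions; refuting it needs a fourfold
  `T` over an essentially-finite-type regular local fourfold base, regular off the closed fibre,
  with NO resolution that is an isomorphism off the closed fibre — again a summit-class object.
  The implication itself (completion descent) is paper-true (excellence of `S`: regular formal
  fibres for the ascent of the hypotheses; `𝒪_T̂ ⧸ 𝔪ⁿ = 𝒪_T ⧸ 𝔪ⁿ` and `BlowupsFlatBaseChange` +
  `RegularLocalRingsFlatDescent` for the descent of the fibre-cosupported `J` and of regularity). -/

/-- The residual's conclusion is a restriction of `ResPerfect p`. -/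
theorem resPerfectIntegralDimGeFive_of_resPerfect (p : ℕ) (h : ResPerfect p) :
    ResPerfectIntegralDimGeFive p :=
  fun k _ _ _ X f hsep hft hqc _ _ => h k X f hsep hft hqc inferInstance

/-- The engine's conclusion is a restriction of `ResPerfect p`. -/
theorem resPerfectIntegralDimLeFour_of_resPerfect (p : ℕ) (h : ResPerfect p) :
    ResPerfectIntegralDimLeFour p :=
  fun k _ _ _ X f hsep hft hqc _ _ => h k X f hsep hft hqc inferInstance

/-! ### §7.2 The atom: what its conclusion gives back, and its format -/

/-- **A blow-up with regular source leaves the target regular off the centre** (over `X ∖ Supp J`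
the blow-up is an isomorphism, tree `IsBlowup.isIso_compl`; local rings agree there, tree
`mem_regularLocus_iff_of_isIso_morphismRestrict`). Landed as
`Theorems.PatchingRelPerfect.Negative.isRegularLocalRing_stalk_of_isBlowup_of_notMem_support`.
[folklore] -/
theorem isRegularLocalRing_stalk_of_isBlowup_of_notMem_support {X' X : Scheme.{0}} {π : X' ⟶ X}
    {J : X.IdealSheafData} (hπ : IsBlowup π J) (hreg : Scheme.IsRegular X') {x : X}
    (hx : x ∉ (J.support : Set X)) : IsRegularLocalRing (X.presheaf.stalk x) := by
  let U : X.Opens := ⟨(J.support : Set X)ᶜ, J.support.isClosed.isOpen_compl⟩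
  haveI : IsIso (π ∣_ U) := hπ.isIso_compl
  obtain ⟨z, hz⟩ := (ConcreteCategory.bijective_of_isIso (π ∣_ U).base).2 ⟨x, hx⟩
  have hπz : π.base z.1 = x := by
    have := morphismRestrict_base_coe π U z
    rw [hz] at this
    exact this.symm
  have hzU : π.base z.1 ∈ U := by rw [hπz]; exact hx
  have h := (mem_regularLocus_iff_of_isIso_morphismRestrict π U z.1 hzU).mp
    (by rw [Scheme.mem_regularLocus]; exact hreg z.1)
  rw [Scheme.mem_regularLocus, hπz] at h
  exact h

/-- **A blow-up with non-empty source is along a non-zero ideal sheaf** (the blowing up of the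
zero ideal is empty: its exceptional divisor would be cut out by the regular element `0`). So in
the atom the clause `J ≠ ⊥` is IMPLIED by `T' ≠ ∅`; it excludes exactly the empty blow-up.
Landed as `Theorems.PatchingRelPerfect.Negative.isBlowup_ne_bot_of_nonempty`. [folklore] -/
theorem isBlowup_ne_bot_of_nonempty {X' X : Scheme.{0}} {π : X' ⟶ X} {J : X.IdealSheafData}
    (hπ : IsBlowup π J) [Nonempty X'] : J ≠ ⊥ := by
  rintro rfl
  obtain ⟨x'⟩ := ‹Nonempty X'›
  obtain ⟨W, hxW, g, hg, hW⟩ := hπ.isEffectiveCartier x'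
  obtain ⟨y, hy⟩ := nonempty_basicOpen_of_mem_nonZeroDivisors W hxW g hg
  have hyW : y ∈ (W : X'.Opens) := X'.basicOpen_le g hy
  have hsupp : y ∈ (((⊥ : X.IdealSheafData).comap π).support : Set X') := by
    rw [Scheme.IdealSheafData.support_comap]
    change π.base y ∈ ((⊥ : X.IdealSheafData).support : Set X)
    rw [Scheme.IdealSheafData.support_bot]
    trivial
  rw [SetLike.mem_coe, Scheme.IdealSheafData.mem_support_iff_of_mem hyW, hW] at hsupp
  simp only [Scheme.mem_zeroLocus_iff, SetLike.mem_coe] at hsupp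
  exact hsupp g (Ideal.mem_span_singleton_self g) hy

/-- **The atom's conclusion IS a fibre-free resolution of `T`** (proper: Stacks 02NS, tree
`stacks02NS_holds`; birational: Stacks 02ND, tree `IsBlowup.isBirational'`; isomorphism off the
closed fibre: `IsBlowup.isIso_morphismRestrict`). Hence `PunctualCompletePerfect p n` implies the
COMPLETE-base analogue of `FibreFreePerfClosed p n`, and the weak typing of the conclusion carries
no junk a prover could exploit (no empty / parasitic `T'`). Landed as
`Theorems.PatchingRelPerfect.Negative.isResolution_and_isIso_offFibre_of_atomConclusion`.
[folklore] -/
theorem isResolution_and_isIso_offFibre_of_atomConclusion {S : Type} [CommRing S] [IsLocalRing S]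
    {T T' : Scheme.{0}} [IsIntegral T] [IsLocallyNoetherian T] (f : T ⟶ Spec (.of S))
    {J : T.IdealSheafData} {π : T' ⟶ T} (hJ0 : J ≠ ⊥)
    (hJ : ∀ t : T, t ∈ J.support → f.base t = IsLocalRing.closedPoint S) (hπ : IsBlowup π J)
    (hreg : Scheme.IsRegular T') :
    IsResolution π ∧ ∃ U : T.Opens, (∀ t : T, t ∈ U ↔ f.base t ≠ IsLocalRing.closedPoint S) ∧
      IsIso (π ∣_ U) := by
  refine ⟨hπ.isResolution' stacks02NS_holds hJ0 hreg, ?_⟩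
  have hopen : IsOpen (f.base ⁻¹' {IsLocalRing.closedPoint S})ᶜ :=
    (IsClosed.preimage f.base.hom.continuous
      (IsLocalRing.isClosed_singleton_closedPoint (R := S))).isOpen_compl
  refine ⟨⟨(f.base ⁻¹' {IsLocalRing.closedPoint S})ᶜ, hopen⟩, fun t => Iff.rfl, ?_⟩
  apply hπ.isIso_morphismRestrict
  rw [Set.disjoint_left]
  intro t ht hts
  exact ht (hJ t hts)

/-- **FORMAT: towers of fibre-supported blow-ups collapse to one** (Raynaud; Stacks 080B; Temkin
2008 Lemma 2.1.4; tree `IsBlowup.exists_isBlowup_comp_supported`), in the atom's own terms: two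
successive blow-ups of a `T` proper over a Noetherian local base, along ideals cosupported over the
closed point, ending in a non-empty regular scheme, give ONE non-zero `J` cosupported in the closed
fibre with regular blowing up. By induction the same for any finite tower: the single-blow-up
format of the atom is EQUIVALENT to "desingularization by finitely many blow-ups centred over the
closed point" — the output format of every resolution algorithm — so no refutation of the atom can
come from its format. Landed as `Theorems.PatchingRelPerfect.Negative.atomConclusion_of_two_step`.
[cite: StacksProject, Tag 080B] -/
theorem atomConclusion_of_two_step {S : Type} [CommRing S] [IsLocalRing S] [IsNoetherianRing S]
    {T T₁ T₂ : Scheme.{0}} (f : T ⟶ Spec (.of S)) [IsProper f]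
    {π₁ : T₁ ⟶ T} {J₁ : T.IdealSheafData} (h₁ : IsBlowup π₁ J₁)
    (hJ₁ : ∀ t : T, t ∈ J₁.support → f.base t = IsLocalRing.closedPoint S)
    {π₂ : T₂ ⟶ T₁} {J₂ : T₁.IdealSheafData} (h₂ : IsBlowup π₂ J₂)
    (hJ₂ : ∀ t : T₁, t ∈ J₂.support → f.base (π₁.base t) = IsLocalRing.closedPoint S)
    [Nonempty T₂] (hreg : Scheme.IsRegular T₂) :
    ∃ (J : T.IdealSheafData) (T' : Scheme.{0}) (π : T' ⟶ T), J ≠ ⊥ ∧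
      (∀ t : T, t ∈ J.support → f.base t = IsLocalRing.closedPoint S) ∧
      IsBlowup π J ∧ Scheme.IsRegular T' := by
  haveI : IsLocallyNoetherian T := LocallyOfFiniteType.isLocallyNoetherian f
  haveI : CompactSpace T := QuasiCompact.compactSpace_of_compactSpace f
  haveI : IsNoetherian T := {}
  obtain ⟨Q, hQ, hsupp⟩ := h₁.exists_isBlowup_comp_supported π₁ J₁ π₂ J₂
    (f.base ⁻¹' {IsLocalRing.closedPoint S}) (fun t ht => hJ₁ t ht) h₂ (fun t ht => hJ₂ t ht)
  exact ⟨Q, T₂, π₂ ≫ π₁, isBlowup_ne_bot_of_nonempty hQ, fun t ht => hsupp ht, hQ, hreg⟩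

/-! ### §7.3 Load-bearing analysis of the atom's hypotheses -/

/-- (A1) The atom with "`T` regular off the closed fibre" DROPPED. -/
def PunctualCompletePerfectNoOffFibre (p n : ℕ) : Prop :=
  ∀ (S : Type) [CommRing S] [IsRegularLocalRing S] [CharP S p]
    [IsAdicComplete (IsLocalRing.maximalIdeal S) S]
    [PerfectField (IsLocalRing.ResidueField S)], ringKrullDim S ≤ n →
    ∀ (T : Scheme.{0}) (f : T ⟶ Spec (.of S)), IsIntegral T → IsProper f → IsBirational f →
      ∃ (J : T.IdealSheafData) (T' : Scheme.{0}) (π : T' ⟶ T), J ≠ ⊥ ∧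
        (∀ t : T, t ∈ J.support → f.base t = IsLocalRing.closedPoint S) ∧
        IsBlowup π J ∧ Scheme.IsRegular T'

/-- (A1) "Every integral `T` proper and birational over such a base is regular off the closed
fibre" — the dropped hypothesis as a universal statement. TRUE for `n ≤ 2` (over the punctured
spectrum of a regular local ring of dimension `≤ 2` a proper birational integral `T` is finite,
hence an isomorphism, `S` being normal), FALSE from `n = 3` on: the blowing up `T` of
`S = κ[[x,y,z]]` (`κ` any perfect field of characteristic `p`) along `I = (x², y³)` is integral,
projective and birational over `Spec S`, and at the point `𝔭 = (x, y, w)` of the chart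
`S[w]/(x²w − y³) = S[I/x²]`, which lies over the NON-closed point `(x, y)` of `Spec S`, the local
ring is `S[w]_{(x,y,w)}/(x²w − y³)` with `x²w − y³ ∈ 𝔫²` — not regular. -/
def OffFibreRegularAll (p n : ℕ) : Prop :=
  ∀ (S : Type) [CommRing S] [IsRegularLocalRing S] [CharP S p]
    [IsAdicComplete (IsLocalRing.maximalIdeal S) S]
    [PerfectField (IsLocalRing.ResidueField S)], ringKrullDim S ≤ n →
    ∀ (T : Scheme.{0}) (f : T ⟶ Spec (.of S)), IsIntegral T → IsProper f → IsBirational f →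
      ∀ t : T, f.base t ≠ IsLocalRing.closedPoint S → IsRegularLocalRing (T.presheaf.stalk t)

/-- (A1) **Off-fibre regularity is load-bearing**: the atom WITHOUT it is exactly the atom PLUS the
universal off-fibre regularity statement — because the atom's conclusion forces off-fibre
regularity of `T` (`isRegularLocalRing_stalk_of_isBlowup_of_notMem_support`). With
`¬ OffFibreRegularAll p n` for `n ≥ 3` (previous docstring) the mutated atom is FALSE in the
line's dimension `4`: any proof of `stub_punctualCompletePerfectFour` must use the hypothesis, and
no re-typing may weaken it (e.g. to "regular at the generic point"). Formal half landed as
`Theorems.PatchingRelPerfect.Negative.offFibre_regular_of_atom_without_offFibre_hyp`. [folklore] -/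
theorem punctualCompletePerfectNoOffFibre_iff (p n : ℕ) :
    PunctualCompletePerfectNoOffFibre p n ↔ PunctualCompletePerfect p n ∧ OffFibreRegularAll p n := by
  refine ⟨fun h => ⟨fun S _ _ _ _ _ hdim T f hT hf hbir _ => h S hdim T f hT hf hbir,
    fun S _ _ _ _ _ hdim T f hT hf hbir t ht => ?_⟩,
    fun h S _ _ _ _ _ hdim T f hT hf hbir => h.1 S hdim T f hT hf hbir (h.2 S hdim T f hT hf hbir)⟩
  obtain ⟨J, T', π, -, hJ, hπ, hreg⟩ := h S hdim T f hT hf hbir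
  exact isRegularLocalRing_stalk_of_isBlowup_of_notMem_support hπ hreg fun hx => ht (hJ t hx)

/-- (A1) NEAR-MISS (not closed in Lean): **`OffFibreRegularAll p 3` is false** by the explicit
blow-up `Bl_{(x²,y³)} Spec κ[[x,y,z]]` of the previous docstrings. Obstruction to a kernel proof:
the witness needs the chart ring of `affineBlowup (x², y³)` identified with `S[w]/(x²w − y³)`
(`reesChartEquiv` / `blowupAlgebra` of `AffineBlowupAlgebra.lean` give `S[I/x²] ⊆ S[1/x]`; the
presentation and the membership `x²w − y³ ∈ 𝔫²` with the embedding-dimension count are unbuilt for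
power series in three variables) — several hundred lines of commutative algebra for a fact nobody
doubts; recorded, not attempted this cycle. -/
theorem not_offFibreRegularAll_three (p : ℕ) (hp : p.Prime) : ¬ OffFibreRegularAll p 3 := by
  sorry

/-- (A1) Hence (modulo the near-miss) the atom without off-fibre regularity is FALSE already at
`n = 3`, where the atom itself is Cossart–Piltant territory. -/
theorem not_punctualCompletePerfectNoOffFibre_three (p : ℕ) (hp : p.Prime) :
    ¬ PunctualCompletePerfectNoOffFibre p 3 := fun h =>
  not_offFibreRegularAll_three p hp ((punctualCompletePerfectNoOffFibre_iff p 3).mp h).2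

/-- (A2) The atom with `IsBirational f` DROPPED. -/
def PunctualCompletePerfectNoBirational (p n : ℕ) : Prop :=
  ∀ (S : Type) [CommRing S] [IsRegularLocalRing S] [CharP S p]
    [IsAdicComplete (IsLocalRing.maximalIdeal S) S]
    [PerfectField (IsLocalRing.ResidueField S)], ringKrullDim S ≤ n →
    ∀ (T : Scheme.{0}) (f : T ⟶ Spec (.of S)), IsIntegral T → IsProper f →
      (∀ t : T, f.base t ≠ IsLocalRing.closedPoint S → IsRegularLocalRing (T.presheaf.stalk t)) →
      ∃ (J : T.IdealSheafData) (T' : Scheme.{0}) (π : T' ⟶ T), J ≠ ⊥ ∧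
        (∀ t : T, t ∈ J.support → f.base t = IsLocalRing.closedPoint S) ∧
        IsBlowup π J ∧ Scheme.IsRegular T'

/-- (A2) **`IsBirational f` is load-bearing — without it the dimension bound is void**: already at
`n = 0`, taking for `S` the perfect ground field `κ` itself (a field is a zero-dimensional complete
regular local ring with perfect residue field `κ`), the mutated atom desingularizes EVERY integral
scheme proper over EVERY perfect field of characteristic `p`, in every dimension, by one blow-up —
resolution over perfect fields in all dimensions in Temkin's format, i.e. more than `ResPerfect p`
restricted to proper integral `X`. Birationality is what ties `dim T` to `dim S ≤ 4`. Landed as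
`Theorems.PatchingRelPerfect.Negative.resolution_all_dims_of_atom_without_birational`. [folklore] -/
theorem resolution_all_dims_of_punctualNoBirational_zero (p : ℕ)
    (h : PunctualCompletePerfectNoBirational p 0) (κ : Type) [Field κ] [CharP κ p] [PerfectField κ]
    (X : Scheme.{0}) (f : X ⟶ Spec (.of κ)) [IsIntegral X] [IsProper f] :
    ∃ (X' : Scheme.{0}) (π : X' ⟶ X), IsResolution π ∧
      ∃ J : X.IdealSheafData, J ≠ ⊥ ∧ IsBlowup π J := by
  haveI : IsAdicComplete (IsLocalRing.maximalIdeal κ) κ := by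
    rw [IsLocalRing.maximalIdeal_eq_bot]
    infer_instance
  haveI : PerfectField (IsLocalRing.ResidueField κ) :=
    PerfectField.of_ringEquiv (RingEquiv.ofBijective (IsLocalRing.residue κ)
      ⟨(IsLocalRing.residue κ).injective, IsLocalRing.residue_surjective⟩)
  have hdim : ringKrullDim κ ≤ (0 : ℕ) := by
    rw [ringKrullDim_eq_zero_of_field κ]
    rfl
  have hoff : ∀ t : X, f.base t ≠ IsLocalRing.closedPoint κ →
      IsRegularLocalRing (X.presheaf.stalk t) :=
    fun t ht => absurd (Subsingleton.elim _ _) ht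
  obtain ⟨J, X', π, hJ, -, hbl, hreg⟩ := h κ hdim X f ‹_› ‹_› hoff
  haveI : IsLocallyNoetherian X := LocallyOfFiniteType.isLocallyNoetherian f
  exact ⟨X', π, hbl.isResolution' stacks02NS_holds hJ hreg, J, hJ, hbl⟩

/-- (A2′) In particular the mutated atom at `n = 0` gives weak resolution of every integral proper
scheme over every perfect field of characteristic `p` — all dimensions. -/
theorem hasResolution_all_dims_of_punctualNoBirational_zero (p : ℕ)
    (h : PunctualCompletePerfectNoBirational p 0) (κ : Type) [Field κ] [CharP κ p] [PerfectField κ]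
    (X : Scheme.{0}) (f : X ⟶ Spec (.of κ)) [IsIntegral X] [IsProper f] :
    Scheme.HasResolution X := by
  obtain ⟨X', π, hres, -⟩ := resolution_all_dims_of_punctualNoBirational_zero p h κ X f
  exact ⟨X', π, hres⟩

/-- (A3) **The base case `n = 0` of the atom HOLDS** (every `p`; sanity and non-vacuity of the
typing): over a zero-dimensional regular local base every point is the closed point, a birational
`f` is an isomorphism over `U = Spec S`, so `T` is regular and `J = ⊤` (the EMPTY centre; `⊤ ≠ ⊥`
because `T ≠ ∅`) with the identity blow-up answers. Shows: (i) `J ≠ ⊥` is satisfiable by the unit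
ideal and is the right exclusion (only the empty blow-up is barred; a prover facing an already
regular `T` answers `J = ⊤`); (ii) the hypotheses are jointly satisfiable; (iii) an induction on
`n` has a free base. Landed as `Theorems.PatchingRelPerfect.Negative.punctual_atom_dim_zero`.
[folklore] -/
theorem punctualCompletePerfect_zero (p : ℕ) : PunctualCompletePerfect p 0 := by
  intro S _ _ _ _ _ hdim T f hT _ hbir _
  haveI : Ring.KrullDimLE 0 S := Ring.krullDimLE_iff.mpr hdim
  have hpt : ∀ x : PrimeSpectrum S, x = IsLocalRing.closedPoint S := fun x =>
    PrimeSpectrum.ext (IsLocalRing.eq_maximalIdeal x.isPrime.isMaximal')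
  obtain ⟨U, hU, -, hiso⟩ := hbir
  haveI := hiso
  have hmem : ∀ t : T, f.base t ∈ U := by
    intro t
    obtain ⟨u, hu⟩ := hU.nonempty
    have h1 : f.base t = IsLocalRing.closedPoint S := hpt (f.base t)
    have h2 : u = IsLocalRing.closedPoint S := hpt u
    rw [h1, ← h2]
    exact hu
  haveI : IsRegularRing S := isRegularRing_of_isRegularLocalRing S
  have hSreg : Scheme.IsRegular (Spec (.of S)) := Scheme.isRegular_Spec (.of S)
  have hTreg : Scheme.IsRegular T := fun t => by
    have := (mem_regularLocus_iff_of_isIso_morphismRestrict f U t (hmem t)).mpr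
      (by rw [Scheme.mem_regularLocus]; exact hSreg _)
    rwa [Scheme.mem_regularLocus] at this
  exact ⟨⊤, T, 𝟙 T, isBlowup_ne_bot_of_nonempty (isBlowup_id_top T), fun t _ => hpt (f.base t),
    isBlowup_id_top T, hTreg⟩

/-- (A4) The atom is MONOTONE in `n` (trivial; recorded so that `stub_punctualCompletePerfectFour`
is read as "dimension ≤ 4", containing the Cossart–Piltant range `n ≤ 3` where it is printed-true
for every residue field, and so that a kill at any `n ≤ 4` kills the stub). -/
theorem punctualCompletePerfect_mono {p m n : ℕ} (hmn : m ≤ n) (h : PunctualCompletePerfect p n) :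
    PunctualCompletePerfect p m :=
  fun S _ _ _ _ _ hdim T f hT hf hbir hoff =>
    h S (hdim.trans (by exact_mod_cast hmn)) T f hT hf hbir hoff

/-! ### §7.4 Hypotheses of the atom NOT formalised this cycle (paper analysis)

* `[PerfectField (ResidueField S)]` dropped: the all-residue-field punctual statement — STRONGER,
  expected true (it is local strong resolution in dimension `≤ 4`), irrefutable; perfectness is a
  TOOL (CP2019 Prop. 2.5 / 2.15, Kollár p. 43), not a truth condition. Not load-bearing for truth,
  load-bearing for the line's METHOD only.
* `[IsAdicComplete 𝔪 S]` dropped: STRONGER (every regular local `S` of equal characteristic `p`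
  with perfect residue field); expected true for quasi-excellent `S` (the line only ever feeds
  completions of local rings of varieties), no counterexample visible even for non-excellent `S`
  (the singular locus of `T` lives in the closed fibre, a variety over the residue field);
  completeness is a CONVENIENCE (Cohen structure `S ≅ κ[[x₁..x_d]]`), probably removable, not a
  truth condition.
* `ringKrullDim S ≤ 4` dropped: all dimensions — summit-class (Temkin-format local resolution in
  char `p`), irrefutable.
* `IsProper f` dropped: `T` of finite type birational over `S`, regular off the closed fibre —
  still implied by algorithmic resolution (blow up over `Sing T ⊆` closed fibre); irrefutable.
  (`IsProper` is used by the LINE — Zariski compactness / globalisation — not by the atom's truth.)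
* `IsIntegral T` weakened to "reduced off the closed fibre": blow-ups kill sections supported on
  the centre (`Bl_J T = Bl_J (T / H⁰_J)`), so embedded nilpotents along the closed fibre are
  harmless and integrality is probably NOT load-bearing beyond irreducibility, which birationality
  (dense iso locus) already forces. Not formalised (needs torsion-killing for `IsBlowup`).
* `J ≠ ⊥`: implied by `T' ≠ ∅` (`isBlowup_ne_bot_of_nonempty`), and forced by the support clause
  whenever `T` has a point off the closed fibre (`dim S ≥ 1`): near-redundant, harmless. -/

/-! ## §6 Regimes tried (cycle 1) and why none bites

* Junk / degenerate instances of the ANTECEDENT (to make the crux vacuously true, or to locate a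
  misstatement): `O = K` (H7′), `K = k`, `trdeg ≤ 1`, divisorial `O` (H7), Abhyankar places
  (H8c), `R = ⊥`, finite `k = 𝔽_p` — all TRUE instances; `trdeg ≤ 3` TRUE mod CP2019 (§4). The
  two ways to make the antecedent false (drop `K/k` f.g., drop `R` f.g.) are visible traps
  (H3)/(H5), not present in the crux as typed.
* Junk instances of the CONSEQUENT (to make the crux false "for the wrong reason"): `X = ∅`,
  `X = Spec k`, regular `X` (C5) — true; non-reduced / non-finite-type `X` are excluded by the
  typed hypotheses and ARE counterexamples when those are dropped (C1)/(C2); reducible and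
  non-equidimensional `X` are genuine instances (`IsBirational` = iso over a dense open with dense
  preimage handles finitely many components; tree `hasResolution_of_irreducibleComponents`).
* Small / finite models: none exist — the antecedent quantifies over all function fields over all
  perfect fields of characteristic `p`; no decidable fragment carries content (H7), and the
  consequent's smallest open case is a fourfold (§4).
* Barrier catalogue (`Literature/Barriers/ResolutionOfSingularities/`): `DimensionFourFrontier`
  (LU₄ ∧ patching up to dim 4 unknown) is CONCEDED by the crux, not contradicted — it is a
  frontier, not a no-go; `InseparableBaseChange` / `RegularNotGeometricallyRegular` do not bite
  (one perfect ground field throughout; regular = smooth over perfect `k`); kangaroo / Hauser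
  barriers concern LU engines, not patching.
* Literature for a printed counterexample to "LU ⇒ resolution": none (Piltant 2013 p. 2: the
  patching problems are OPEN in dimension ≥ 4; Teissier names the step as an open problem); the
  implication is a theorem in dim ≤ 3 (Zariski 1944 / Cossart–Piltant) and in char 0 (vacuously,
  Hironaka).
* `ledger negatives --problem ResolutionOfSingularities`: 1 entry (DefectlessFrames 19085,
  unrelated to patching).

Cycle 2 (line `closed-point-slice`, §7): degenerate bases of the atom (`dim S = 0`: TRUE,
`punctualCompletePerfect_zero`; `T = Spec S`: true with `J = ⊤`); junk outputs (`T' = ∅` barred by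
`J ≠ ⊥` ⟺ `T' ≠ ∅`; parasitic components impossible: the output is an honest fibre-free resolution,
§7.2); the FORMAT (single blow-up ⟺ fibre-supported tower, §7.2 — not a restriction); hypothesis
mutation of the atom (off-fibre regularity: load-bearing, forced by the conclusion; birationality:
load-bearing, voids the dimension bound; perfect / complete / proper / integral: stronger or
near-redundant variants, none refutable); the three other stubs (consequences of weak resp. strong
resolution). Literature for "a fourfold germ over `κ[[u₁..u₄]]`, `κ` perfect, not resolvable by
blow-ups over the closed point": none — CP2019 Rem. 3.2 records an invariant INCREASE under a
permissible blow-up in dimension 4, not non-resolvability; Hauser–Perlega cycles are unforced.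
-/

end Summit.ResolutionOfSingularities.ResolutionOfSingularities.Cruxes.PatchingRelPerfect.Disproof

end
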